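import Literature.Probability.RandomPlanarGeometry.KernelConvergence
import Literature.Probability.RandomPlanarGeometry.JordanDomainInterior
import Literature.Analysis.Complex.KoebeDistortion
import Literature.Analysis.Complex.InjectiveHolomorphic
import HarnessLib

/-!
# `BoundaryClosureR` (stmt-CriticalPhenomena-14004), line `polygon-parity-squeeze`, stub
# `stub_gateStability` (GS), part IV: the normal-family toolkit of the kernel argument

Abstract (domain-free) steps of the Carathéodory-kernel argument behind gate stability, for the
NORMALISED GATE REFLECTIONS `G_k = F_k / F_k'(b)` of frames of inner domains (univalent on the gate
disc `B = B(b, R₁)`, `G_k(b) = 0`, `G_k'(b) = 1`, `Im G_k > 0` on the upper half-disc `B⁺`) and the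
rescaled INVERSE FRAMES `ψ_k : ℍₒ → P_k ⊆ Ω`:

* `gateFamily_locallyBounded` — `(G_k)` is locally bounded on `B` (Koebe's growth theorem), hence
  normal (Montel);
* `gateLimit_basic` — a locally uniform limit `G̃` of `(G_k)` on `B` is univalent with `G̃(b) = 0`,
  `G̃'(b) = 1`, maps `B⁺` into `ℍₒ` (Hurwitz, open mapping), and `G_k' → G̃'` locally uniformly;
* `inverse_limit` — the bounded family `(ψ_k)` has a locally uniform limit `ψ̃` on `ℍₒ` along a
  subsequence, with `ψ̃ ∘ G̃ = id` on `B⁺`, `ψ̃` univalent, `ψ̃(ℍₒ) ⊆ closure Ω` (Montel, Hurwitz);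
* `mapsTo_carrier_of_mapsTo_closure` — an open set inside the closure of a Jordan domain lies in the
  domain, so `ψ̃(ℍₒ) ⊆ Ω`;
* `local_limit` — on an open connected `V` eventually inside the inner domains, the rescaled frames
  have locally uniform subsequential limits `g : V → ℍₒ` with `ψ̃ ∘ g = id` (Montel into `ℍₒ`).

References: Pommerenke, *Boundary Behaviour of Conformal Maps* (1992), Thm. 1.3, Thm. 1.8
(Carathéodory kernel theorem); Conway, *Functions of One Complex Variable I* (1978), VII.2.
-/

noncomputable section

open scoped Topology
open Filter Set Metric Complex Bornology Function
open UpperHalfPlane (upperHalfPlaneSet isOpen_upperHalfPlaneSet)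
open Literature.Probability.RandomPlanarGeometry

namespace Summit.CriticalPhenomena.SAWScalingLimit.Theorems.PolygonParitySqueeze.GateStability

/-! ### 0. Two elementary facts -/

/-- Locally uniform convergence along `atTop` is inherited by subsequences (any index map tending
to `atTop`). [folklore] -/
theorem tendstoLocallyUniformlyOn_comp_index {F : ℕ → ℂ → ℂ} {f : ℂ → ℂ} {s : Set ℂ}
    (h : TendstoLocallyUniformlyOn F f atTop s) {φ : ℕ → ℕ} (hφ : Tendsto φ atTop atTop) :
    TendstoLocallyUniformlyOn (fun n => F (φ n)) f atTop s := fun u hu x hx => by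
  obtain ⟨t, ht, hev⟩ := h u hu x hx
  exact ⟨t, ht, hφ.eventually hev⟩

/-- The upper half-disc `{im > im b} ∩ B(b, R)` is open and preconnected (convex). [folklore] -/
theorem isOpen_isPreconnected_upperHalfDisc (b : ℂ) (R : ℝ) :
    IsOpen ({z : ℂ | b.im < z.im} ∩ ball b R) ∧ IsPreconnected ({z : ℂ | b.im < z.im} ∩ ball b R) :=
  ⟨(isOpen_lt continuous_const continuous_im).inter isOpen_ball,
    ((convex_halfSpace_im_gt _).inter (convex_ball b R)).isPreconnected⟩

/-! ### 1. Normality of the normalised gate reflections -/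

/-- **The normalised univalent family is locally bounded** (Koebe's growth theorem): for `F_k`
holomorphic and injective on `B(b, R₁)` with `F_k(b) = 0`, the functions `F_k / F_k'(b)` are
bounded on every smaller concentric disc by `R₁ t/(1 − t)²`, hence locally bounded on `B(b, R₁)`.
[cite: PommerenkeBBCM1992, Thm. 1.3] -/
theorem gateFamily_locallyBounded {b : ℂ} {R₁ : ℝ} (hR₁ : 0 < R₁) {FP : ℕ → ℂ → ℂ}
    (hFPd : ∀ k, DifferentiableOn ℂ (FP k) (ball b R₁)) (hFPinj : ∀ k, InjOn (FP k) (ball b R₁))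
    (hFPb : ∀ k, FP k b = 0) :
    ∀ z ∈ ball b R₁, ∃ M : ℝ, ∃ r > 0, ∀ k, ∀ w ∈ ball z r ∩ ball b R₁,
      ‖FP k w / deriv (FP k) b‖ ≤ M := by
  intro z hz
  rw [mem_ball, dist_eq_norm] at hz
  set r : ℝ := (R₁ - ‖z - b‖) / 2 with hrdef
  have hr : 0 < r := by rw [hrdef]; linarith
  set t₁ : ℝ := (‖z - b‖ + r) / R₁ with ht₁def
  have ht₁ : t₁ < 1 := by rw [ht₁def, div_lt_one hR₁]; rw [hrdef]; linarith
  have ht₁0 : 0 ≤ t₁ := by positivity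
  refine ⟨R₁ * (t₁ / (1 - t₁) ^ 2), r, hr, fun k w hw => ?_⟩
  have hne : deriv (FP k) b ≠ 0 :=
    Literature.Analysis.Complex.SCV.deriv_ne_zero_of_injOn (hFPd k) isOpen_ball (hFPinj k)
      (mem_ball_self hR₁)
  have hk := (Literature.Analysis.Complex.AreaThm.distortion_ball hR₁ (hFPd k) (hFPinj k) hw.2).2.2
  rw [hFPb k, sub_zero] at hk
  set t : ℝ := ‖w - b‖ / R₁ with htdef
  have ht : t ≤ t₁ := by
    rw [htdef, ht₁def]
    gcongr
    have h1 : ‖w - z‖ < r := by rw [← dist_eq_norm]; exact mem_ball.1 hw.1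
    calc ‖w - b‖ = ‖(w - z) + (z - b)‖ := by ring_nf
      _ ≤ ‖w - z‖ + ‖z - b‖ := norm_add_le _ _
      _ ≤ ‖z - b‖ + r := by linarith
  have ht0 : 0 ≤ t := by positivity
  have hmono : t / (1 - t) ^ 2 ≤ t₁ / (1 - t₁) ^ 2 := by
    rw [div_le_div_iff₀ (by nlinarith) (by nlinarith)]
    have h1 : (1 - t₁) ^ 2 ≤ (1 - t) ^ 2 := by nlinarith
    nlinarith
  rw [norm_div, div_le_iff₀ (norm_pos_iff.2 hne)]
  calc ‖FP k w‖ ≤ ‖deriv (FP k) b‖ * R₁ * (t / (1 - t) ^ 2) := hk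
    _ ≤ ‖deriv (FP k) b‖ * R₁ * (t₁ / (1 - t₁) ^ 2) := by gcongr
    _ = R₁ * (t₁ / (1 - t₁) ^ 2) * ‖deriv (FP k) b‖ := by ring

/-! ### 2. Subsequential limits of the normalised gate reflections -/

/-- **Basic properties of a kernel limit on the gate disc.** Let `F_k` be holomorphic and
injective on `B = B(b, R₁)` with `F_k(b) = 0`, `F_k'(b) > 0` real, `Im F_k > 0` on the upper
half-disc `B⁺`, and let `G_k = F_k/F_k'(b) → G̃` locally uniformly on `B`.  Then `G̃` is holomorphic
and injective on `B` (Hurwitz), `G̃(b) = 0`, `G̃'(b) = 1`, `G̃(B⁺) ⊆ ℍₒ` (open mapping), and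
`G_k' → G̃'` locally uniformly on `B`. [cite: PommerenkeBBCM1992, Thm. 1.8] -/
theorem gateLimit_basic {b : ℂ} {R₁ : ℝ} (hR₁ : 0 < R₁) {FP : ℕ → ℂ → ℂ}
    (hFPd : ∀ k, DifferentiableOn ℂ (FP k) (ball b R₁)) (hFPinj : ∀ k, InjOn (FP k) (ball b R₁))
    (hFPb : ∀ k, FP k b = 0) (hc : ∀ k, 0 < (deriv (FP k) b).re ∧ (deriv (FP k) b).im = 0)
    (hup : ∀ k, ∀ z ∈ {z : ℂ | b.im < z.im} ∩ ball b R₁, 0 < (FP k z).im) {Gl : ℂ → ℂ}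
    (hGl : TendstoLocallyUniformlyOn (fun k z => FP k z / deriv (FP k) b) Gl atTop (ball b R₁)) :
    DifferentiableOn ℂ Gl (ball b R₁) ∧ Gl b = 0 ∧ deriv Gl b = 1 ∧ InjOn Gl (ball b R₁) ∧
      MapsTo Gl ({z : ℂ | b.im < z.im} ∩ ball b R₁) upperHalfPlaneSet ∧
      TendstoLocallyUniformlyOn (fun k z => deriv (FP k) z / deriv (FP k) b) (deriv Gl) atTop
        (ball b R₁) := by
  have hbB : b ∈ ball b R₁ := mem_ball_self hR₁
  have hne : ∀ k, deriv (FP k) b ≠ 0 := fun k h => by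
    have := (hc k).1; rw [h, zero_re] at this; exact lt_irrefl _ this
  have hGd : ∀ k, DifferentiableOn ℂ (fun z => FP k z / deriv (FP k) b) (ball b R₁) := fun k =>
    (hFPd k).div_const _
  have hGd' : ∀ᶠ k in atTop, DifferentiableOn ℂ (fun z => FP k z / deriv (FP k) b) (ball b R₁) :=
    Eventually.of_forall hGd
  have hGld : DifferentiableOn ℂ Gl (ball b R₁) := hGl.differentiableOn hGd' isOpen_ball
  -- derivatives
  have hderiv : TendstoLocallyUniformlyOn (fun k z => deriv (FP k) z / deriv (FP k) b) (deriv Gl)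
      atTop (ball b R₁) := by
    have h := hGl.deriv hGd' isOpen_ball
    refine h.congr fun k z _ => ?_
    simp only [Function.comp_apply, deriv_div_const]
  have hGlb : Gl b = 0 := by
    have h1 := hGl.tendsto_at hbB
    have h2 : Tendsto (fun k => FP k b / deriv (FP k) b) atTop (𝓝 0) :=
      tendsto_const_nhds.congr fun k => by rw [hFPb k, zero_div]
    exact tendsto_nhds_unique h1 h2
  have hGl1 : deriv Gl b = 1 := by
    have h1 := hderiv.tendsto_at hbB
    have h2 : Tendsto (fun k => deriv (FP k) b / deriv (FP k) b) atTop (𝓝 1) :=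
      tendsto_const_nhds.congr fun k => by rw [div_self (hne k)]
    exact tendsto_nhds_unique h1 h2
  -- injectivity (Hurwitz)
  have hinj' : ∀ᶠ k in atTop, InjOn (fun z => FP k z / deriv (FP k) b) (ball b R₁) :=
    Eventually.of_forall fun k z hz w hw heq => hFPinj k hz hw (by
      have := congrArg (· * deriv (FP k) b) heq
      simpa only [div_mul_cancel₀ _ (hne k)] using this)
  have hGlinj : InjOn Gl (ball b R₁) := by
    rcases Complex.exists_eqOn_const_or_injOn_of_tendstoLocallyUniformlyOn isOpen_ball
      (convex_ball b R₁).isPreconnected hGd' hinj' hGl with ⟨c, hcst⟩ | h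
    · exfalso
      have hev : Gl =ᶠ[𝓝 b] fun _ => c := by
        filter_upwards [isOpen_ball.mem_nhds hbB] with z hz using hcst hz
      have := hev.deriv_eq
      rw [deriv_const, hGl1] at this
      exact one_ne_zero this
    · exact h
  -- values on the upper half-disc
  set Bp : Set ℂ := {z : ℂ | b.im < z.im} ∩ ball b R₁ with hBpdef
  obtain ⟨hBpo, hBpc⟩ := isOpen_isPreconnected_upperHalfDisc b R₁
  have hnonneg : ∀ z ∈ Bp, 0 ≤ (Gl z).im := by
    intro z hz
    refine ge_of_tendsto ((continuous_im.tendsto _).comp (hGl.tendsto_at hz.2))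
      (Eventually.of_forall fun k => ?_)
    have hre : deriv (FP k) b = ((deriv (FP k) b).re : ℂ) := Complex.ext (by simp) (by simp [(hc k).2])
    show 0 ≤ (FP k z / deriv (FP k) b).im
    rw [hre, div_ofReal_im]
    exact div_nonneg (hup k z hz).le (hc k).1.le
  have hmaps : MapsTo Gl Bp upperHalfPlaneSet := by
    intro z hz
    have hopen : IsOpen (Gl '' Bp) := by
      rcases ((hGld.mono inter_subset_right).analyticOnNhd hBpo).is_constant_or_isOpen hBpc with
        ⟨c, hcst⟩ | h
      · exfalso
        -- two distinct points of `Bp`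
        obtain ⟨ε, hε, hεsub⟩ := Metric.isOpen_iff.1 hBpo z hz
        have hz' : z + ((ε / 2 : ℝ) : ℂ) ∈ Bp := hεsub (by
          rw [mem_ball, dist_eq_norm, add_sub_cancel_left, norm_real, Real.norm_of_nonneg
            (by positivity)]
          linarith)
        have heq := hGlinj hz.2 hz'.2 ((hcst z hz).trans (hcst _ hz').symm)
        have : ((ε / 2 : ℝ) : ℂ) = 0 := by
          have := congrArg (· - z) heq; simpa using this.symm
        rw [ofReal_eq_zero] at this
        linarith
      · exact h Bp subset_rfl hBpo
    rcases (hnonneg z hz).lt_or_eq with hlt | heq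
    · exact hlt
    · exfalso
      obtain ⟨ε, hε, hball⟩ := Metric.isOpen_iff.1 hopen (Gl z) ⟨z, hz, rfl⟩
      have hmem : Gl z - ((ε / 2 : ℝ) : ℂ) * I ∈ ball (Gl z) ε := by
        rw [mem_ball, dist_eq_norm, sub_sub_cancel_left, norm_neg, norm_mul, norm_I, mul_one,
          norm_real, Real.norm_of_nonneg (by positivity)]
        linarith
      obtain ⟨w, hw, hweq⟩ := hball hmem
      have := hnonneg w hw
      rw [hweq, sub_im, ← heq] at this
      simp at this
      linarith
  exact ⟨hGld, hGlb, hGl1, hGlinj, hmaps, hderiv⟩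

/-! ### 3. The inverse family and its limit -/

/-- **The limit of the rescaled inverse frames.** Let `ψ_k : ℍₒ → Ω` be holomorphic, injective,
with values in the bounded set `Ω`, and let `G_k → G̃` locally uniformly on an open set `S` with
`G_k(S) ⊆ ℍₒ`, `G̃(S) ⊆ ℍₒ` and `ψ_k ∘ G_k = id` on `S` (`S` containing two distinct points).  Then
along a subsequence `ψ_k → ψ̃` locally uniformly on `ℍₒ`, where `ψ̃` is holomorphic and INJECTIVE
on `ℍₒ` with `ψ̃ ∘ G̃ = id` on `S` and `ψ̃(ℍₒ) ⊆ closure Ω` (Montel for the bounded family; the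
limit is not constant because it inverts `G̃` on `S`, hence univalent by Hurwitz).
[cite: PommerenkeBBCM1992, Thm. 1.8] -/
theorem inverse_limit {Ω S : Set ℂ} (hΩb : IsBounded Ω) {z₁ z₁' : ℂ} (hz₁ : z₁ ∈ S)
    (hz₁' : z₁' ∈ S) (hne : z₁ ≠ z₁')
    {ψ : ℕ → ℂ → ℂ} (hψd : ∀ k, DifferentiableOn ℂ (ψ k) upperHalfPlaneSet)
    (hψm : ∀ k, MapsTo (ψ k) upperHalfPlaneSet Ω) (hψinj : ∀ k, InjOn (ψ k) upperHalfPlaneSet)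
    {G : ℕ → ℂ → ℂ} {Gl : ℂ → ℂ}
    (hGS : ∀ k, ∀ z ∈ S, G k z ∈ upperHalfPlaneSet ∧ ψ k (G k z) = z)
    (hGl : TendstoLocallyUniformlyOn G Gl atTop S) (hGlS : MapsTo Gl S upperHalfPlaneSet) :
    ∃ (κ : ℕ → ℕ) (ψl : ℂ → ℂ), StrictMono κ ∧ DifferentiableOn ℂ ψl upperHalfPlaneSet ∧
      TendstoLocallyUniformlyOn (fun i => ψ (κ i)) ψl atTop upperHalfPlaneSet ∧
      (∀ z ∈ S, ψl (Gl z) = z) ∧ InjOn ψl upperHalfPlaneSet ∧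
      MapsTo ψl upperHalfPlaneSet (closure Ω) := by
  obtain ⟨Rb, hRb⟩ := hΩb.subset_closedBall 0
  have hbound : ∀ k, ∀ w ∈ upperHalfPlaneSet, ‖ψ k w‖ ≤ Rb := fun k w hw =>
    mem_closedBall_zero_iff.1 (hRb (hψm k hw))
  obtain ⟨ψl, κ, hκ, hψld, hlim, -⟩ :=
    Complex.exists_strictMono_tendstoLocallyUniformlyOn_of_norm_le isOpen_upperHalfPlaneSet hψd hbound
  -- `ψ̃ ∘ G̃ = id` on `S`
  have hleft : ∀ z ∈ S, ψl (Gl z) = z := by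
    intro z hz
    have hg : Tendsto (fun i => G (κ i) z) atTop (𝓝[upperHalfPlaneSet] (Gl z)) :=
      tendsto_nhdsWithin_iff.2 ⟨(hGl.tendsto_at hz).comp hκ.tendsto_atTop,
        Eventually.of_forall fun i => (hGS _ z hz).1⟩
    have h1 := hlim.tendsto_comp (hψld.continuousOn.continuousWithinAt (hGlS hz)) (hGlS hz) hg
    have h2 : Tendsto (fun i => ψ (κ i) (G (κ i) z)) atTop (𝓝 z) :=
      tendsto_const_nhds.congr fun i => ((hGS _ z hz).2).symm
    exact tendsto_nhds_unique h1 h2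
  -- not constant, hence injective
  have hnc : ∀ c : ℂ, ¬ EqOn ψl (fun _ => c) upperHalfPlaneSet := by
    intro c hc
    have h1 := hleft z₁ hz₁
    have h2 := hleft z₁' hz₁'
    rw [hc (hGlS hz₁)] at h1
    rw [hc (hGlS hz₁')] at h2
    exact hne (h1.symm.trans h2)
  have hinj : InjOn ψl upperHalfPlaneSet := by
    rcases Complex.exists_eqOn_const_or_injOn_of_tendstoLocallyUniformlyOn isOpen_upperHalfPlaneSet
      (convex_halfSpace_im_gt 0).isPreconnected (Eventually.of_forall fun i => hψd _)
      (Eventually.of_forall fun i => hψinj _) hlim with ⟨c, hc⟩ | h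
    · exact absurd hc (hnc c)
    · exact h
  refine ⟨κ, ψl, hκ, hψld, hlim, hleft, hinj, fun w hw => ?_⟩
  exact mem_closure_of_tendsto (hlim.tendsto_at hw) (Eventually.of_forall fun i => hψm _ hw)

/-- **An open set fenced by a Jordan domain lies inside it**: a holomorphic injective map on an
open preconnected set `U` (with two distinct points) taking values in `closure Ω`, `Ω` the carrier
of a Jordan domain, takes values in `Ω` (its image is open and bounded with frontier in
`closure Ω`; `JordanDomain.interior_subset_of_frontier_subset_closure`). [folklore] -/
theorem mapsTo_carrier_of_mapsTo_closure (J : JordanDomain) {f : ℂ → ℂ} {U : Set ℂ}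
    (hU : IsOpen U) (hUc : IsPreconnected U) (hf : DifferentiableOn ℂ f U) (hinj : InjOn f U)
    {x y : ℂ} (hx : x ∈ U) (hy : y ∈ U) (hxy : x ≠ y)
    (hmaps : MapsTo f U (closure J.carrier)) : MapsTo f U J.carrier := by
  have hopen : IsOpen (f '' U) := by
    rcases (hf.analyticOnNhd hU).is_constant_or_isOpen hUc with ⟨c, hc⟩ | h
    · exact absurd (hinj hx hy ((hc x hx).trans (hc y hy).symm)) hxy
    · exact h U subset_rfl hU
  have hsub : f '' U ⊆ closure J.carrier := by
    rintro _ ⟨z, hz, rfl⟩; exact hmaps hz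
  have hbdd : IsBounded (f '' U) := J.isBounded.closure.subset hsub
  have hfr : frontier (f '' U) ⊆ closure J.carrier :=
    frontier_subset_closure.trans ((closure_mono hsub).trans isClosed_closure.closure_subset)
  have key := (J.interior_subset_of_frontier_subset_closure hbdd hfr).1
  rw [hopen.interior_eq] at key
  exact fun z hz => key ⟨z, hz, rfl⟩

/-! ### 4. Local limits of the rescaled frames -/

/-- **Local limits of the rescaled frames invert `ψ̃`.** Let `ψ_i → ψ̃` locally uniformly on `ℍₒ`
with `ψ̃` holomorphic, and let `H_i` (for `i ≥ i₀`) be holomorphic maps of an open preconnected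
set `V` into `ℍₒ` with `ψ_i ∘ H_i = id` on `V`, non-degenerate at one point
(`H_i(z₁) → w₁ ∈ ℍₒ`).  Then along a subsequence `H_{i₀+ι(j)} → g` locally uniformly on `V`, with
`g : V → ℍₒ` holomorphic and `ψ̃ ∘ g = id` on `V` (Montel into the half-plane).
[cite: PommerenkeBBCM1992, Thm. 1.8] -/
theorem local_limit {ψ : ℕ → ℂ → ℂ} {ψl : ℂ → ℂ} (hψld : DifferentiableOn ℂ ψl upperHalfPlaneSet)
    (hlim : TendstoLocallyUniformlyOn ψ ψl atTop upperHalfPlaneSet)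
    {V : Set ℂ} (hVo : IsOpen V) (hVc : IsPreconnected V) {H : ℕ → ℂ → ℂ} {i₀ : ℕ}
    (hHd : ∀ i, i₀ ≤ i → DifferentiableOn ℂ (H i) V)
    (hHm : ∀ i, i₀ ≤ i → MapsTo (H i) V upperHalfPlaneSet)
    (hHψ : ∀ i, i₀ ≤ i → ∀ z ∈ V, ψ i (H i z) = z)
    {z₁ : ℂ} (hz₁ : z₁ ∈ V) {w₁ : ℂ} (hw₁ : w₁ ∈ upperHalfPlaneSet)
    (hz₁lim : Tendsto (fun i => H i z₁) atTop (𝓝 w₁)) :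
    ∃ (ι : ℕ → ℕ) (g : ℂ → ℂ), StrictMono ι ∧ DifferentiableOn ℂ g V ∧ MapsTo g V upperHalfPlaneSet ∧
      TendstoLocallyUniformlyOn (fun j => H (ι j + i₀)) g atTop V ∧ ∀ z ∈ V, ψl (g z) = z := by
  set Hs : ℕ → ℂ → ℂ := fun i => H (i + i₀) with hHsdef
  have hHsd : ∀ i, DifferentiableOn ℂ (Hs i) V := fun i => hHd _ (Nat.le_add_left _ _)
  have hHsm : ∀ i, MapsTo (Hs i) V upperHalfPlaneSet := fun i => hHm _ (Nat.le_add_left _ _)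
  have hz₁lim' : Tendsto (fun i => Hs i z₁) atTop (𝓝 w₁) :=
    (tendsto_add_atTop_iff_nat i₀).2 hz₁lim
  obtain ⟨ι, g, hι, hgd, hgm, hglim⟩ := exists_subseq_tendstoLocallyUniformlyOn_of_mapsTo hVo hVc
    hHsd hHsm (z := fun _ => z₁) (fun _ => hz₁) hz₁ tendsto_const_nhds hw₁ hz₁lim'
  refine ⟨ι, g, hι, hgd, hgm, hglim, fun z hz => ?_⟩
  have hidx : Tendsto (fun j => ι j + i₀) atTop atTop :=
    tendsto_atTop_mono (fun j => Nat.le_add_right _ _) hι.tendsto_atTop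
  have hlim' := tendstoLocallyUniformlyOn_comp_index hlim hidx
  have hg : Tendsto (fun j => Hs (ι j) z) atTop (𝓝[upperHalfPlaneSet] (g z)) :=
    tendsto_nhdsWithin_iff.2 ⟨hglim.tendsto_at hz, Eventually.of_forall fun j => hHsm _ hz⟩
  have h1 := hlim'.tendsto_comp (hψld.continuousOn.continuousWithinAt (hgm hz)) (hgm hz) hg
  have h2 : Tendsto (fun j => ψ (ι j + i₀) (Hs (ι j) z)) atTop (𝓝 z) :=
    tendsto_const_nhds.congr fun j => (hHψ _ (Nat.le_add_left _ _) z hz).symm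
  exact tendsto_nhds_unique h1 h2

/-! ### Registered form -/

/-- **Registered helper `gateStability_gateLimitBasic`** (∀-closed form of `gateLimit_basic`;
sub-goal of stub `stub_gateStability`, crux stmt-CriticalPhenomena-14004, line
`polygon-parity-squeeze`): kernel limits of the normalised gate reflections are univalent,
normalised, map the upper half-disc into `ℍₒ`, with convergent derivatives.
[cite: PommerenkeBBCM1992, Thm. 1.8] -/
theorem gateStability_gateLimitBasic : ∀ (b : ℂ) (R₁ : ℝ), 0 < R₁ → ∀ (FP : ℕ → ℂ → ℂ), (∀ k, DifferentiableOn ℂ (FP k) (Metric.ball b R₁)) → (∀ k, Set.InjOn (FP k) (Metric.ball b R₁)) → (∀ k, FP k b = 0) → (∀ k, 0 < (deriv (FP k) b).re ∧ (deriv (FP k) b).im = 0) → (∀ k, ∀ z ∈ {z : ℂ | b.im < z.im} ∩ Metric.ball b R₁, 0 < (FP k z).im) → ∀ (Gl : ℂ → ℂ), TendstoLocallyUniformlyOn (fun k z => FP k z / deriv (FP k) b) Gl Filter.atTop (Metric.ball b R₁) → DifferentiableOn ℂ Gl (Metric.ball b R₁) ∧ Gl b = 0 ∧ deriv Gl b =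 1 ∧ Set.InjOn Gl (Metric.ball b R₁) ∧ Set.MapsTo Gl ({z : ℂ | b.im < z.im} ∩ Metric.ball b R₁) UpperHalfPlane.upperHalfPlaneSet ∧ TendstoLocallyUniformlyOn (fun k z => deriv (FP k) z / deriv (FP k) b) (deriv Gl) Filter.atTop (Metric.ball b R₁) :=
  fun _ _ hR₁ _ hFPd hFPinj hFPb hc hup _ hGl => gateLimit_basic hR₁ hFPd hFPinj hFPb hc hup hGl

end Summit.CriticalPhenomena.SAWScalingLimit.Theorems.PolygonParitySqueeze.GateStability

end
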